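import Literature.NumberTheory.EllipticCurves.Kobayashi2003.CyclotomicTowerSignedSelmer
import Literature.NumberTheory.EllipticCurves.Kobayashi2003.SignedSelmerModuleFiniteProofs
import Literature.NumberTheory.EllipticCurves.Kobayashi2003.SignedSelmerDualUniquenessProofs
import Literature.NumberTheory.EllipticCurves.IwasawaGeneratorChangeProofs
import Literature.NumberTheory.EllipticCurves.ZpExtensionUnitTwistProofs
import Literature.NumberTheory.EllipticCurves.PeriodIndexCorestrictionLocal
import Literature.NumberTheory.EllipticCurves.IwasawaAlgebraProofs
import Literature.NumberTheory.EllipticCurves.IwasawaOrderKernelRankProofs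
import HarnessLib

/-!
# The signed Iwasawa invariants "torsion" and "`μ = 0`" of `X^±(E/K_∞)` do not depend on the
# cyclotomic `ℤ_p`-extension datum `(κ, γ)` (proofs)

`Proofs` file (theorems only; no definition, no named fact) in the cluster `Kobayashi2003`, the SIGNED
companion of `IwasawaGeneratorChangeProofs.lean` (which does this for the unsigned `X(E/K_∞)`,
hypothesis structure `SelmerDualData W κ γ`). The statements of the tree about Kobayashi's
`X^ε(E/K_∞) = Sel^ε(E/K_∞)^∨` (`SignedSelmerDualData W κ γ ε`, Def. 1.1, `SignedSelmer.lean`) quantify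
over a `ℤ_p`-extension datum `κ : Γ_K ↠ ℤ_p` and an element `γ`; some (Kobayashi's main conjecture
`KobayashiMainConjecture`, its Eisenstein half `KobayashiLowerDivisibility`) normalise `γ` further by
`IsCyclotomicVariable p γ` (to match the variable of Pollack's `L^±_p(E,T)`), others ("`X^±` is
`Λ`-torsion with `μ^± = 0` for every cyclotomic top-generator pair") do not. Two cyclotomic data differ
by a unit twist `κ₂ = u • κ₁` (`ZpExtension.IsCyclotomic.exists_eq_unitTwist_holds`), which changes
neither the kernel nor the layer subgroups (`kerSubgroup_unitTwist`, `layerSubgroup_unitTwist`), but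
the signed Selmer groups `signedSelmerInfty W κᵢ ε` live in the (propositionally, not definitionally,
equal) groups `H¹(ker κᵢ, E[p^∞])`. This file proves that the two invariants are nevertheless the same:

* §1 `signedLocalPointsOfEmb_eq_of_layerSubgroup_eq` — Kobayashi's `E^ε(K_n·E)` depends on `κ` only
  through the layer subgroups (the tree's `localLayerPointsOfEmb_eq`, `localTraceOfEmb_eq_localPairTraceOfEmb`
  are definitional);
* §2 `resOfLe_mem_localKummerOverOfEmb` — restriction `H¹(H) → H¹(H')`, `H' ≤ H`, preserves the Kummer
  local condition cut out by any `A` (same cocycle, same point `Q`);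
* §3 `resOfLe_mem_signedSelmerLayer_of_layerSubgroup_eq`, `resOfLe_mem_signedSelmerInfty_of_eq` —
  restriction along EQUAL layer/kernel subgroups carries `Sel^ε(E/K_n)` to `Sel^ε(E/K_n)` and
  `Sel^ε(E/K_∞)` to `Sel^ε(E/K_∞)` (`resOfLe_mem_selmerGroupOver`, `resOfLe_comp_conjH1`, §1–§2);
* §4 `exists_addEquiv_signedSelmerInfty_of_eq` — hence an additive isomorphism
  `Sel^ε_∞(κ₂) ≃ Sel^ε_∞(κ₁)` given by restriction (inverse restrictions compose to the identity,
  `resOfLe_comp`, `resOfLe_refl`); `SignedSelmerDualData.exists_linearEquiv_int_of_addEquiv` — for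
  Pontryagin-dual data `D₁` (over `κ₁, γ₁`) and `D₂` (over `κ₂, γ₂`) any such isomorphism induces a
  `ℤ_p`-LINEAR isomorphism `X₁ ≃ X₂` (constants act through `ℤ_p → ℤ/p^k` on `p^k`-torsion classes,
  `toDual_C_smul`); `…isTorsion_of_isTorsion_of_addEquiv` (via `ℚ_p ⊗ X`, as in the unsigned file),
  `…mu_eq_zero_of_mu_eq_zero_of_addEquiv` (`μ = 0 ⟺ X` finitely generated over `ℤ_p`,
  `muInvariant_eq_zero_iff_finite`, for f.g. torsion `X`);
* §5 `SignedSelmerDualData.isTorsion_of_isTorsion_of_isCyclotomic`,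
  `SignedSelmerDualData.mu_eq_zero_of_mu_eq_zero_of_isCyclotomic` — **for cyclotomic `κ₁, κ₂` and
  ANY `γ₁, γ₂` (top generators, for finite generation): `X^ε` torsion for `(κ₁, γ₁)` ⟹ torsion for
  `(κ₂, γ₂)`, and then `μ^ε = 0` for `(κ₁, γ₁)` ⟹ `μ^ε = 0` for `(κ₂, γ₂)`**.
(`λ` and `ord_T` are not treated here; cf. the unsigned file.) Consumer: the W-ALL cell's item
stmt-BirchSwinnertonDyer-20312 (skeleton stub `stub_generatorChangeCMTwo`), where "`μ⁺ = 0`" obtained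
from the main conjecture at NORMALISED pairs must be moved to all top-generator pairs.

Source. Greenberg, LNM 1716, §1 (p. 60 of the held Cetraro volume): the `Λ`-structure of
`H¹(F_∞, E[p^∞])` is that of `ℤ_p⟦Γ⟧`, identified with `ℤ_p⟦T⟧` by a CHOICE of topological generator
(Washington §7.1, Thm. 7.1; §13.1: the cyclotomic `ℤ_p`-extension is unique, its parametrisations
differ by `ℤ_pˣ`); Kobayashi, Invent. Math. 152 (2003), Def. 1.1 and the sentence following it
("`ℤ_p[[Γ]]` acts naturally on the Pontryagin dual of `Sel^±(E/F_∞)`") — a property of the GROUP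
`Sel^±(E/F_∞)` with its `Γ`-action, independent of coordinates.

## References
* [Kobayashi2003] S. Kobayashi, Invent. Math. 152 (2003), Def. 1.1 (p. 2), §2 (p. 4).
* [GreenbergLNM1716] R. Greenberg, LNM 1716 (1999), §1 (p. 60).
* [Washington1997] L. C. Washington, *Introduction to Cyclotomic Fields*, §7.1, §13.1–13.2.
* [NeukirchSchmidtWingberg2008] J. Neukirch, A. Schmidt, K. Wingberg, (5.3.5), I.§5.
-/

noncomputable section

open scoped Classical TensorProduct

universe u

namespace Literature.NumberTheory.EllipticCurves.Kobayashi2003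

open Literature.NumberTheory.EllipticCurves Literature.NumberTheory.GaloisRepresentations ZpExtension

/-! ## §1 The signed local points depend on `κ` only through its layer subgroups -/

section LocalPoints

variable {K : Type u} [Field K] {p : ℕ} [Fact p.Prime] {E : Type u} [Field E] [Algebra K E]
  (ι : AlgebraicClosure K →ₐ[K] AlgebraicClosure E) (W : WeierstrassCurve K)

/-- The pair trace `Tr_{L₂/L₁}` at `ι` only depends on the pair of subgroups (congruence along
equalities, absorbing the finite-index instances). [cite: Kobayashi2003, §2 p. 4 (the trace maps Tr_{n/m+1})] -/
theorem localPairTraceOfEmb_congr {H₁ H₁' H₂ H₂' : Subgroup (Field.absoluteGaloisGroup K)}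
    [H₂.FiniteIndex] [H₂'.FiniteIndex] (h₁ : H₁ = H₁') (h₂ : H₂ = H₂') :
    localPairTraceOfEmb ι W H₁ H₂ = localPairTraceOfEmb ι W H₁' H₂' := by
  subst h₁; subst h₂; rfl

/-- **`E^ε(K_n·E)` depends on `κ` only through its layer subgroups**: if `κ₁⁻¹(pⁿℤ_p) = κ₂⁻¹(pⁿℤ_p)`
for all `n` (e.g. `κ₂ = u • κ₁`), then `signedLocalPointsOfEmb κ₁ ι W ε n = signedLocalPointsOfEmb κ₂ ι W ε n`
(Def. 1.1 is phrased through `E(K_m·E)` and the traces `Tr_{n/m+1}`, i.e. through the subgroups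
`Gal(K̄/K_m)`: `localLayerPointsOfEmb_eq`, `localTraceOfEmb_eq_localPairTraceOfEmb`).
[cite: Kobayashi2003, Def. 1.1] -/
theorem signedLocalPointsOfEmb_eq_of_layerSubgroup_eq {κ₁ κ₂ : ZpExtension K p}
    (hL : ∀ n, κ₁.layerSubgroup n = κ₂.layerSubgroup n) (ε : ℤˣ) (n : ℕ) :
    signedLocalPointsOfEmb κ₁ ι W ε n = signedLocalPointsOfEmb κ₂ ι W ε n := by
  have key : ∀ m, localTraceOfEmb κ₁ ι W (m + 1) n = localTraceOfEmb κ₂ ι W (m + 1) n := fun m => by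
    rw [localTraceOfEmb_eq_localPairTraceOfEmb (ι := ι) (W := W) κ₁ (m + 1) n,
      localTraceOfEmb_eq_localPairTraceOfEmb (ι := ι) (W := W) κ₂ (m + 1) n]
    exact localPairTraceOfEmb_congr ι W (hL (m + 1)) (hL n)
  have keyL : ∀ m, localLayerPointsOfEmb κ₁ ι W m = localLayerPointsOfEmb κ₂ ι W m := fun m => by
    rw [localLayerPointsOfEmb_eq, localLayerPointsOfEmb_eq, hL m]
  ext P
  simp only [mem_signedLocalPointsOfEmb_iff, key, keyL]

end LocalPoints


/-! ## §2 Restriction preserves Kobayashi's Kummer local condition -/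

section Kummer

variable {K : Type u} [Field K] (W : WeierstrassCurve K) (p : ℕ)
  {E : Type u} [Field E] [Algebra K E] (ι : AlgebraicClosure K →ₐ[K] AlgebraicClosure E)

/-- **Restriction preserves the Kummer local condition.** For `H' ≤ H ≤ Γ_K` and any subgroup `A` of
local points: if `c ∈ H¹(H, E[p^∞])` satisfies Kobayashi's Kummer condition cut out by `A` at `ι`
(`c = [φ]`, `ι φ(τ|) = τQ − Q` on `Gal(K̄_E/L_w)`, `pᵏQ ∈ A`), then so does `res_{H'}^{H} c` (same `Q`,
same `k`, the restricted cocycle; `Gal(K̄_E/L'_w) ≤ Gal(K̄_E/L_w)`). [cite: Kobayashi2003, Def. 1.1 and §2 p. 4] -/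
theorem resOfLe_mem_localKummerOverOfEmb {H H' : Subgroup (Field.absoluteGaloisGroup K)} (h : H' ≤ H)
    (A : AddSubgroup (localPoints W E)) {c : W.subgroupH1 p H}
    (hc : c ∈ localKummerOverOfEmb W p H ι A) :
    W.resOfLe p h c ∈ localKummerOverOfEmb W p H' ι A := by
  obtain ⟨φ, Q, k, rfl, hA, hτ⟩ := (mem_localKummerOverOfEmb_iff A c).mp hc
  rw [WeierstrassCurve.resOfLe, resOfLe, resH1Hom_oneCocycleClass, mem_localKummerOverOfEmb_iff]
  refine ⟨_, Q, k, rfl, hA, fun τ => ?_⟩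
  have hτH : (τ : Field.absoluteGaloisGroup E) ∈ localSubgroupOfEmb H ι :=
    Subgroup.mem_comap.mpr (h (Subgroup.mem_comap.mp τ.2))
  exact hτ ⟨τ, hτH⟩

end Kummer


/-! ## §3 Restriction along equal layer / kernel subgroups preserves the signed Selmer groups -/

section Selmer

variable {K : Type u} [Field K] [NumberField K] (W : WeierstrassCurve K) {p : ℕ} [Fact p.Prime]

/-- **Restriction along equal layer subgroups preserves `Sel^ε(E/K_n)`**: for `κ₁, κ₂` with the same
layer subgroups, `res : H¹(κ₂⁻¹(pⁿℤ_p), E[p^∞]) → H¹(κ₁⁻¹(pⁿℤ_p), E[p^∞])` (along the equality) maps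
`signedSelmerLayer W κ₂ ε n` into `signedSelmerLayer W κ₁ ε n`: the classical conditions by
`resOfLe_mem_selmerGroupOver`, the conjugates by `resOfLe_comp_conjH1`, the signed Kummer condition by
§1–§2. [cite: Kobayashi2003, Def. 1.1] -/
theorem resOfLe_mem_signedSelmerLayer_of_layerSubgroup_eq {κ₁ κ₂ : ZpExtension K p}
    (hL : ∀ n, κ₁.layerSubgroup n = κ₂.layerSubgroup n) (ε : ℤˣ) (n : ℕ)
    {c : W.subgroupH1 p (κ₂.layerSubgroup n)} (hc : c ∈ signedSelmerLayer W κ₂ ε n) :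
    W.resOfLe p (hL n).le c ∈ signedSelmerLayer W κ₁ ε n := by
  rw [mem_signedSelmerLayer_iff] at hc ⊢
  refine ⟨W.resOfLe_mem_selmerGroupOver p (hL n).le hc.1, fun v hv σ => ?_⟩
  have h1 : W.conjH1 p (κ₁.layerSubgroup n) σ (W.resOfLe p (hL n).le c) =
      W.resOfLe p (hL n).le (W.conjH1 p (κ₂.layerSubgroup n) σ c) := by
    change ((W.conjH1 p _ σ).comp (W.resOfLe p _)) c = ((W.resOfLe p _).comp (W.conjH1 p _ σ)) c
    rw [resOfLe_comp_conjH1_holds]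
  rw [h1, show signedLocalPoints κ₁ (v.adicCompletion K) W ε n =
      signedLocalPoints κ₂ (v.adicCompletion K) W ε n from
    signedLocalPointsOfEmb_eq_of_layerSubgroup_eq _ W hL ε n]
  exact resOfLe_mem_localKummerOverOfEmb W p _ (hL n).le _ (hc.2 v hv σ)

/-- **Restriction along equal kernels preserves `Sel^ε(E/K_∞)`**: for `κ₁, κ₂` with the same kernel
and the same layer subgroups, `res : H¹(ker κ₂, E[p^∞]) → H¹(ker κ₁, E[p^∞])` maps
`signedSelmerInfty W κ₂ ε` into `signedSelmerInfty W κ₁ ε` (generators `s_n(c)`, `c ∈ Sel^ε(E/K_n)`: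
`res ∘ s_n = s_n ∘ res` by `resOfLe_comp`, and the previous lemma). [cite: Kobayashi2003, Def. 1.1] -/
theorem resOfLe_mem_signedSelmerInfty_of_eq {κ₁ κ₂ : ZpExtension K p}
    (hK : κ₁.kerSubgroup = κ₂.kerSubgroup) (hL : ∀ n, κ₁.layerSubgroup n = κ₂.layerSubgroup n)
    (ε : ℤˣ) {s : W.subgroupH1 p κ₂.kerSubgroup} (hs : s ∈ signedSelmerInfty W κ₂ ε) :
    W.resOfLe p hK.le s ∈ signedSelmerInfty W κ₁ ε := by
  refine AddSubgroup.iSup_induction (fun n => (signedSelmerLayer W κ₂ ε n).map (W.layerToInfty κ₂ n))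
    (C := fun s => W.resOfLe p hK.le s ∈ signedSelmerInfty W κ₁ ε) hs ?_ ?_ ?_
  · rintro n s ⟨c, hc, rfl⟩
    refine map_layerToInfty_signedSelmerLayer_le W κ₁ ε n ⟨W.resOfLe p (hL n).le c,
      resOfLe_mem_signedSelmerLayer_of_layerSubgroup_eq W hL ε n hc, ?_⟩
    change ((W.resOfLe p (κ₁.kerSubgroup_le_layerSubgroup n)).comp (W.resOfLe p (hL n).le)) c =
      ((W.resOfLe p hK.le).comp (W.resOfLe p (κ₂.kerSubgroup_le_layerSubgroup n))) c
    rw [W.resOfLe_comp_holds p, W.resOfLe_comp_holds p]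
  · rw [map_zero]; exact zero_mem _
  · intro s t hs ht; rw [map_add]; exact add_mem hs ht

end Selmer


/-! ## §4 The comparison of signed Selmer groups and of their Pontryagin duals -/

section Dual

variable {K : Type u} [Field K] [NumberField K] (W : WeierstrassCurve K) {p : ℕ} [Fact p.Prime]

/-- **`Sel^ε_∞(κ₂) ≃ Sel^ε_∞(κ₁)` by restriction** when `ker κ₁ = ker κ₂` and the layer subgroups
agree: the two restrictions along the equality are mutually inverse (`resOfLe_comp`, `resOfLe_refl`).
An existence statement (no definitions in this proof file). [cite: Kobayashi2003, Def. 1.1]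
[cite: GreenbergLNM1716, §1 p. 60] -/
theorem exists_addEquiv_signedSelmerInfty_of_eq {κ₁ κ₂ : ZpExtension K p}
    (hK : κ₁.kerSubgroup = κ₂.kerSubgroup) (hL : ∀ n, κ₁.layerSubgroup n = κ₂.layerSubgroup n)
    (ε : ℤˣ) :
    ∃ Ψ : signedSelmerInfty W κ₂ ε ≃+ signedSelmerInfty W κ₁ ε,
      ∀ s, ((Ψ s : signedSelmerInfty W κ₁ ε) : W.subgroupH1 p κ₁.kerSubgroup) =
        W.resOfLe p hK.le s := by
  let f : signedSelmerInfty W κ₂ ε →+ signedSelmerInfty W κ₁ ε :=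
    ((W.resOfLe p hK.le).comp (signedSelmerInfty W κ₂ ε).subtype).codRestrict _
      fun s => resOfLe_mem_signedSelmerInfty_of_eq W hK hL ε s.2
  let g : signedSelmerInfty W κ₁ ε →+ signedSelmerInfty W κ₂ ε :=
    ((W.resOfLe p hK.ge).comp (signedSelmerInfty W κ₁ ε).subtype).codRestrict _
      fun s => resOfLe_mem_signedSelmerInfty_of_eq W hK.symm (fun n => (hL n).symm) ε s.2
  have hgf : ∀ s, g (f s) = s := fun s => by
    apply Subtype.ext
    change ((W.resOfLe p hK.ge).comp (W.resOfLe p hK.le)) (s : W.subgroupH1 p κ₂.kerSubgroup) = s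
    rw [W.resOfLe_comp_holds p]
    exact congrArg (fun φ => φ (s : W.subgroupH1 p κ₂.kerSubgroup))
      (resOfLe_refl_holds (M := W.geomPrimaryTorsion p) κ₂.kerSubgroup)
  have hfg : ∀ s, f (g s) = s := fun s => by
    apply Subtype.ext
    change ((W.resOfLe p hK.le).comp (W.resOfLe p hK.ge)) (s : W.subgroupH1 p κ₁.kerSubgroup) = s
    rw [W.resOfLe_comp_holds p]
    exact congrArg (fun φ => φ (s : W.subgroupH1 p κ₁.kerSubgroup))
      (resOfLe_refl_holds (M := W.geomPrimaryTorsion p) κ₁.kerSubgroup)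
  exact ⟨AddMonoidHom.toAddEquiv f g (AddMonoidHom.ext hgf) (AddMonoidHom.ext hfg), fun s => rfl⟩

namespace SignedSelmerDualData

variable {W} {ε : ℤˣ}

/-- **Any additive isomorphism `Ψ : Sel^ε_∞(κ₂) ≃ Sel^ε_∞(κ₁)` induces a `ℤ_p`-LINEAR isomorphism
`X₁ ≃ X₂` of Pontryagin-dual data** (over any `γ₁`, `γ₂`; for `ℤ_p`-structures compatible with the
`Λ`-structures): `x ↦ toDual₂⁻¹ (toDual₁ x ∘ Ψ)`; linearity because constants act on both sides through
`ℤ_p → ℤ/pᵏ` on `pᵏ`-torsion classes (`toDual_C_smul`, every class is `p`-power torsion,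
`exists_pow_smul_subgroupH1_ker_eq_zero`, and `Ψ` preserves `pᵏ s = 0`). Signed copy of
`SelmerDualData.exists_linearEquiv_int`. [cite: GreenbergLNM1716, §1 p. 60]
[cite: Kobayashi2003, Def. 1.1 (sentence following it, p. 2)] -/
theorem exists_linearEquiv_int_of_addEquiv {κ₁ κ₂ : ZpExtension K p}
    {γ₁ γ₂ : Field.absoluteGaloisGroup K} (D₁ : SignedSelmerDualData W κ₁ γ₁ ε)
    (D₂ : SignedSelmerDualData W κ₂ γ₂ ε)
    (Ψ : signedSelmerInfty W κ₂ ε ≃+ signedSelmerInfty W κ₁ ε)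
    [Module ℤ_[p] D₁.X] [IsScalarTower ℤ_[p] (IwasawaAlgebra p) D₁.X]
    [Module ℤ_[p] D₂.X] [IsScalarTower ℤ_[p] (IwasawaAlgebra p) D₂.X] :
    ∃ e : D₁.X ≃ₗ[ℤ_[p]] D₂.X, ∀ (x : D₁.X) (s : signedSelmerInfty W κ₂ ε),
      D₂.toDual (e x) s = D₁.toDual x (Ψ s) := by
  let e₁ := AddEquiv.ofBijective D₁.toDual D₁.bijective
  let e₂ := AddEquiv.ofBijective D₂.toDual D₂.bijective
  let F : D₁.X → D₂.X := fun x => e₂.symm ((e₁ x).comp Ψ.toAddMonoidHom)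
  let G : D₂.X → D₁.X := fun y => e₁.symm ((e₂ y).comp Ψ.symm.toAddMonoidHom)
  have keyF : ∀ x s, D₂.toDual (F x) s = D₁.toDual x (Ψ s) := fun x s => by
    change (e₂ (e₂.symm ((e₁ x).comp Ψ.toAddMonoidHom))) s = _
    rw [e₂.apply_symm_apply]
    rfl
  have keyG : ∀ y s, D₁.toDual (G y) s = D₂.toDual y (Ψ.symm s) := fun y s => by
    change (e₁ (e₁.symm ((e₂ y).comp Ψ.symm.toAddMonoidHom))) s = _
    rw [e₁.apply_symm_apply]
    rfl
  refine ⟨{ toFun := F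
            invFun := G
            map_add' := fun x y => ?_
            map_smul' := fun c x => ?_
            left_inv := fun x => ?_
            right_inv := fun y => ?_ }, keyF⟩
  · apply D₂.bijective.injective
    ext s
    rw [map_add, AddMonoidHom.add_apply, keyF, keyF, keyF, map_add, AddMonoidHom.add_apply]
  · -- `ℤ_p`-linearity: compare values on a `p^k`-torsion class `s`
    rw [RingHom.id_apply]
    apply D₂.bijective.injective
    ext s
    obtain ⟨k, hk⟩ := W.exists_pow_smul_subgroupH1_ker_eq_zero κ₂ (s : W.subgroupH1 p κ₂.kerSubgroup)
    have hk' : p ^ k • s = 0 := Subtype.ext (by rw [AddSubgroupClass.coe_nsmul]; exact hk)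
    have hkΨ : p ^ k • Ψ s = 0 := by rw [← map_nsmul, hk', map_zero]
    rw [keyF, ← algebraMap_smul (IwasawaAlgebra p) c x,
      ← algebraMap_smul (IwasawaAlgebra p) c (F x), PowerSeries.algebraMap_eq,
      D₁.toDual_C_smul c x (Ψ s) k hkΨ, D₂.toDual_C_smul c _ s k hk', keyF]
  · apply D₁.bijective.injective
    ext s
    rw [keyG, keyF, AddEquiv.apply_symm_apply]
  · apply D₂.bijective.injective
    ext s
    rw [keyF, keyG, AddEquiv.symm_apply_apply]

/-- **Cotorsion passes along `Ψ`**: if `X₁` is finitely generated and `Λ`-torsion then `X₂` is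
`Λ`-torsion (`ℚ_p ⊗ X₁ ≅ ℚ_p ⊗ X₂` finite-dimensional: `finite_baseChange_of_isTorsion`,
`isTorsion_of_finite_baseChange`). Signed copy of `SelmerDualData.isTorsion_of_isTorsion`.
[cite: GreenbergLNM1716, §1 p. 60] [cite: Washington1997, §13.2] -/
theorem isTorsion_of_isTorsion_of_addEquiv {κ₁ κ₂ : ZpExtension K p}
    {γ₁ γ₂ : Field.absoluteGaloisGroup K} (D₁ : SignedSelmerDualData W κ₁ γ₁ ε)
    (D₂ : SignedSelmerDualData W κ₂ γ₂ ε)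
    (Ψ : signedSelmerInfty W κ₂ ε ≃+ signedSelmerInfty W κ₁ ε)
    [Module.Finite (IwasawaAlgebra p) D₁.X] (h₁ : Module.IsTorsion (IwasawaAlgebra p) D₁.X) :
    Module.IsTorsion (IwasawaAlgebra p) D₂.X := by
  letI : Module ℤ_[p] D₁.X := Module.compHom D₁.X (algebraMap ℤ_[p] (IwasawaAlgebra p))
  haveI : IsScalarTower ℤ_[p] (IwasawaAlgebra p) D₁.X := IsScalarTower.of_compHom ℤ_[p] _ _
  letI : Module ℤ_[p] D₂.X := Module.compHom D₂.X (algebraMap ℤ_[p] (IwasawaAlgebra p))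
  haveI : IsScalarTower ℤ_[p] (IwasawaAlgebra p) D₂.X := IsScalarTower.of_compHom ℤ_[p] _ _
  obtain ⟨e, -⟩ := exists_linearEquiv_int_of_addEquiv D₁ D₂ Ψ
  haveI : Module.Finite ℚ_[p] (ℚ_[p] ⊗[ℤ_[p]] D₁.X) :=
    IwasawaAlgebra.finite_baseChange_of_isTorsion p h₁
  haveI : Module.Finite ℚ_[p] (ℚ_[p] ⊗[ℤ_[p]] D₂.X) :=
    Module.Finite.equiv (e.baseChange ℤ_[p] ℚ_[p] _ _)
  exact IwasawaAlgebra.isTorsion_of_finite_baseChange p (M := D₂.X)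

/-- **`μ = 0` passes along `Ψ`** for finitely generated data with `X₁` torsion: `μ(X) = 0` iff `X`
is finitely generated over `ℤ_p` (`muInvariant_eq_zero_iff_finite`, Washington §13.2), a property
transported by the `ℤ_p`-linear isomorphism of `exists_linearEquiv_int_of_addEquiv`.
[cite: Washington1997, §13.2] [cite: GreenbergLNM1716, §1 p. 60] -/
theorem mu_eq_zero_of_mu_eq_zero_of_addEquiv {κ₁ κ₂ : ZpExtension K p}
    {γ₁ γ₂ : Field.absoluteGaloisGroup K} (D₁ : SignedSelmerDualData W κ₁ γ₁ ε)
    (D₂ : SignedSelmerDualData W κ₂ γ₂ ε)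
    (Ψ : signedSelmerInfty W κ₂ ε ≃+ signedSelmerInfty W κ₁ ε)
    [Module.Finite (IwasawaAlgebra p) D₁.X] [Module.Finite (IwasawaAlgebra p) D₂.X]
    (h₁ : Module.IsTorsion (IwasawaAlgebra p) D₁.X) (hμ : D₁.mu = 0) : D₂.mu = 0 := by
  letI : Module ℤ_[p] D₁.X := Module.compHom D₁.X (algebraMap ℤ_[p] (IwasawaAlgebra p))
  haveI : IsScalarTower ℤ_[p] (IwasawaAlgebra p) D₁.X := IsScalarTower.of_compHom ℤ_[p] _ _
  letI : Module ℤ_[p] D₂.X := Module.compHom D₂.X (algebraMap ℤ_[p] (IwasawaAlgebra p))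
  haveI : IsScalarTower ℤ_[p] (IwasawaAlgebra p) D₂.X := IsScalarTower.of_compHom ℤ_[p] _ _
  have h₂ : Module.IsTorsion (IwasawaAlgebra p) D₂.X := isTorsion_of_isTorsion_of_addEquiv D₁ D₂ Ψ h₁
  obtain ⟨e, -⟩ := exists_linearEquiv_int_of_addEquiv D₁ D₂ Ψ
  have hfin₁ : Module.Finite ℤ_[p] D₁.X := (muInvariant_eq_zero_iff_finite p D₁.X h₁).mp hμ
  haveI : Module.Finite ℤ_[p] D₂.X := Module.Finite.equiv e
  exact (muInvariant_eq_zero_iff_finite p D₂.X h₂).mpr inferInstance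

end SignedSelmerDualData

end Dual

/-! ## §5 Cyclotomic data: torsion-ness and `μ = 0` of `X^ε(E/K_∞)` do not depend on `(κ, γ)` -/

section Cyclotomic

variable {K : Type u} [Field K] [NumberField K] (W : WeierstrassCurve K) {p : ℕ} [Fact p.Prime]

omit [NumberField K] in
/-- Two cyclotomic `ℤ_p`-extension data have the same layer subgroups (they differ by a unit twist:
`IsCyclotomic.exists_eq_unitTwist_holds`, `layerSubgroup_unitTwist`). [cite: Washington1997, §13.1] -/
theorem layerSubgroup_eq_of_isCyclotomic {κ₁ κ₂ : ZpExtension K p} (h₁ : κ₁.IsCyclotomic)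
    (h₂ : κ₂.IsCyclotomic) (n : ℕ) : κ₁.layerSubgroup n = κ₂.layerSubgroup n := by
  obtain ⟨u, hu⟩ := ZpExtension.IsCyclotomic.exists_eq_unitTwist_holds h₁ h₂
  rw [hu, ZpExtension.layerSubgroup_unitTwist]

/-- For cyclotomic `κ₁, κ₂`: `Sel^ε(E/K_∞)` for `κ₂` is isomorphic (by restriction along the equal
kernels) to `Sel^ε(E/K_∞)` for `κ₁`. [cite: Kobayashi2003, Def. 1.1] [cite: Washington1997, §13.1] -/
theorem exists_addEquiv_signedSelmerInfty_of_isCyclotomic {κ₁ κ₂ : ZpExtension K p}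
    (h₁ : κ₁.IsCyclotomic) (h₂ : κ₂.IsCyclotomic) (ε : ℤˣ) :
    Nonempty (signedSelmerInfty W κ₂ ε ≃+ signedSelmerInfty W κ₁ ε) := by
  obtain ⟨Ψ, -⟩ := exists_addEquiv_signedSelmerInfty_of_eq W (h₁.trans h₂.symm)
    (layerSubgroup_eq_of_isCyclotomic h₁ h₂) ε
  exact ⟨Ψ⟩

namespace SignedSelmerDualData

variable {W} {ε : ℤˣ}

/-- **Torsion-ness of `X^ε(E/K_∞)` does not depend on the cyclotomic pair**: for cyclotomic `κ₁, κ₂`,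
`γ₁` a top generator of `κ₁` (finite generation, `moduleFinite`) and any `γ₂`, any data `D₁`, `D₂`:
`X₁` torsion ⟹ `X₂` torsion. [cite: GreenbergLNM1716, §1 p. 60] [cite: Kobayashi2003, Thm. 1.2 (the object only)] -/
theorem isTorsion_of_isTorsion_of_isCyclotomic [W.IsElliptic] {κ₁ κ₂ : ZpExtension K p}
    (h₁ : κ₁.IsCyclotomic) (h₂ : κ₂.IsCyclotomic) {γ₁ γ₂ : Field.absoluteGaloisGroup K}
    (hγ₁ : κ₁.IsTopGenerator γ₁) (D₁ : SignedSelmerDualData W κ₁ γ₁ ε)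
    (D₂ : SignedSelmerDualData W κ₂ γ₂ ε) (hT₁ : Module.IsTorsion (IwasawaAlgebra p) D₁.X) :
    Module.IsTorsion (IwasawaAlgebra p) D₂.X := by
  obtain ⟨Ψ⟩ := exists_addEquiv_signedSelmerInfty_of_isCyclotomic W h₁ h₂ ε
  haveI := D₁.moduleFinite hγ₁
  exact isTorsion_of_isTorsion_of_addEquiv D₁ D₂ Ψ hT₁

/-- **`μ^ε = 0` does not depend on the cyclotomic pair**: for cyclotomic `κ₁, κ₂` with top
generators `γ₁, γ₂` and data `D₁` (torsion) and `D₂`: `D₁.mu = 0 ⟹ D₂.mu = 0`. This moves "`μ⁺ = 0`"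
proved at a normalised pair (`IsCyclotomicVariable`) to every top-generator pair.
[cite: GreenbergLNM1716, §1 p. 60] [cite: Washington1997, §13.2] [cite: Kobayashi2003, Thm. 1.4 (the invariants only)] -/
theorem mu_eq_zero_of_mu_eq_zero_of_isCyclotomic [W.IsElliptic] {κ₁ κ₂ : ZpExtension K p}
    (h₁ : κ₁.IsCyclotomic) (h₂ : κ₂.IsCyclotomic) {γ₁ γ₂ : Field.absoluteGaloisGroup K}
    (hγ₁ : κ₁.IsTopGenerator γ₁) (hγ₂ : κ₂.IsTopGenerator γ₂) (D₁ : SignedSelmerDualData W κ₁ γ₁ ε)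
    (D₂ : SignedSelmerDualData W κ₂ γ₂ ε) (hT₁ : Module.IsTorsion (IwasawaAlgebra p) D₁.X)
    (hμ : D₁.mu = 0) : D₂.mu = 0 := by
  obtain ⟨Ψ⟩ := exists_addEquiv_signedSelmerInfty_of_isCyclotomic W h₁ h₂ ε
  haveI := D₁.moduleFinite hγ₁
  haveI := D₂.moduleFinite hγ₂
  exact mu_eq_zero_of_mu_eq_zero_of_addEquiv D₁ D₂ Ψ hT₁ hμ

end SignedSelmerDualData

end Cyclotomic

end Literature.NumberTheory.EllipticCurves.Kobayashi2003

end
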